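import Literature.Topology.FourManifolds.SurgeryGluingTransport
import Literature.Topology.FourManifolds.NeckCapping
import HarnessLib

/-!
# Surgery on a split link: the two comparison embeddings

Infrastructure (theorems only) for the connected-sum decomposition of surgery on a split link
(`Literature.Topology.FourManifolds.exists_isSurgery_zeroFramedUnlink`, `KirbyCalculus.lean`):
the two open smooth embeddings through which the surgery `Y` on a link `L` (components indexed
by `Option ι`) is compared with the surgery `Y'` on the link `L.someLink` of the components
`some i` and with a surgery `Z` on one further knot `O` (in the application `O` is the unknot and
`Z = 𝕊 2 × 𝕊 1`).

* `Link.exists_iotaEmbedding` — **away from a closed set `C ⊇ K₀` missing the unit tubes of the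
  other components, `Y` and `Y'` agree**: if `Y` is presented on `L` with tubular neighbourhoods
  `ν` and `Y'` on `L.someLink` with the *same* tubular neighbourhoods `ν (some i)`, then the open
  subset `U = Y' ∖ jA' (C)` of `Y'` embeds openly and smoothly into `Y` by the comparison map
  `jA' a ↦ jA a` (`a ∉ C`), `jB'ᵢ b ↦ jB (some i) b` between the two multi-gluings of
  `(𝕊 3 ∖ L') ∖ C` and the solid tori (`exists_diffeomorph_comp_eq_of_multiGluings`,
  Kosinski, *Differential Manifolds* (1993), VI.1, VI.6).
* `exists_betaEmbedding` — **the surgered ball around `K₀` is a punctured surgery on `O`**: if a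
  smooth injective map `μ` of `𝕊 3 ∖ (O ∪ {q₀})` into `𝕊 3 ∖ L` with smooth inverse on its open
  image matches an oriented tubular neighbourhood `ν_O` of `O` with `ν none` on the open unit tube
  up to a symmetry `Fs` of the circle factor (`μ (ν_O (x, t • v)) = ν none (x, t • Fs v)`), and
  `Z` is the open gluing of `𝕊 3 ∖ O` and the open solid torus along `surgeryRel ν_O`, then
  `Z ∖ {φ_Z q₀}` embeds openly and smoothly into `Y` by `φ_Z a ↦ jA (μ a)`, `ψ_Z b ↦ jB none (T b)`
  (`T` the corresponding symmetry of the solid torus), by the comparison of two-piece gluings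
  (`exists_diffeomorph_comp_eq_of_gluings`, `KirbyMovesBlowDown.lean`).

These are the embeddings `jA`, `jB` of Kervaire–Milnor's connected sum `Y ≅ Y' # Z` in the
relative form of the standard model `X # Sⁿ ≅ X` (`ConnectedSumSphereIdentity.lean`), assembled
in `SplitLinkSurgery.lean`.

## References

* A. Kosinski, *Differential Manifolds* (1993), Ch. VI §1, §6.
* M. A. Kervaire, J. W. Milnor, *Groups of homotopy spheres: I*, Ann. of Math. 77 (1963), §2.
* D. Rolfsen, *Knots and Links* (1976), §9.F.
-/

open scoped Manifold ContDiff Topology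
open Set Function Metric

noncomputable section

namespace Literature.Topology.FourManifolds

/-- Local notation: `𝔼 n` is the model Euclidean space `EuclideanSpace ℝ (Fin n)`. -/
local notation "𝔼 " n:arg => EuclideanSpace ℝ (Fin n)

/-- Local notation: `𝕊 n` is the unit sphere in `EuclideanSpace ℝ (Fin (n + 1))`. -/
local notation "𝕊 " n:arg => (Metric.sphere (0 : EuclideanSpace ℝ (Fin (n + 1))) 1)

/-! ### Corestriction of an open smooth embedding (general models) -/

/-- **Corestriction of an open smooth embedding to an open subset containing its image** is an
open smooth embedding — general models (`Manifold.IsSmoothEmbedding.codRestrict_opens`,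
`NeckCapping.lean`, plus openness of the range). [folklore] -/
theorem isSmoothEmbedding_codRestrict_opens_general
    {EM HM : Type*} [NormedAddCommGroup EM] [NormedSpace ℝ EM] [TopologicalSpace HM]
    {IM : ModelWithCorners ℝ EM HM} {X : Type*} [TopologicalSpace X] [ChartedSpace HM X]
    [IsManifold IM ∞ X]
    {EN HN : Type*} [NormedAddCommGroup EN] [NormedSpace ℝ EN] [TopologicalSpace HN]
    {IN : ModelWithCorners ℝ EN HN} {W : Type*} [TopologicalSpace W] [ChartedSpace HN W]
    [IsManifold IN ∞ W] {f : X → W} (hf : Manifold.IsSmoothEmbedding IM IN ∞ f)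
    (ho : IsOpen (range f)) (U : TopologicalSpace.Opens W) (hU : ∀ x, f x ∈ U) :
    Manifold.IsSmoothEmbedding IM IN ∞ (fun x ↦ (⟨f x, hU x⟩ : U)) ∧
      IsOpen (range fun x ↦ (⟨f x, hU x⟩ : U)) := by
  refine ⟨hf.codRestrict_opens U hU, ?_⟩
  have : (range fun x ↦ (⟨f x, hU x⟩ : U)) = Subtype.val ⁻¹' range f := by
    ext ⟨y, hy⟩
    simp only [mem_range, mem_preimage, Subtype.mk.injEq]
  rw [this]
  exact ho.preimage continuous_subtype_val

/-- **The inclusion of an open submanifold is a local diffeomorphism** (general model; the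
partial diffeomorphism is the coercion chart `U.openPartialHomeomorphSubtypeCoe`). [folklore] -/
theorem isLocalDiffeomorph_subtypeVal_opens
    {EM HM : Type*} [NormedAddCommGroup EM] [NormedSpace ℝ EM] [TopologicalSpace HM]
    {IM : ModelWithCorners ℝ EM HM} {X : Type*} [TopologicalSpace X] [ChartedSpace HM X]
    [IsManifold IM ∞ X] (U : TopologicalSpace.Opens X) :
    IsLocalDiffeomorph IM IM ∞ (Subtype.val : U → X) := by
  intro x
  haveI hU : Nonempty U := ⟨x⟩
  set c := U.openPartialHomeomorphSubtypeCoe hU with hc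
  refine ⟨{ toPartialEquiv := c.toPartialEquiv
            open_source := c.open_source
            open_target := c.open_target
            contMDiffOn_toFun := contMDiffOn_openPartialHomeomorphSubtypeCoe U hU
            contMDiffOn_invFun := contMDiffOn_openPartialHomeomorphSubtypeCoe_symm U hU },
    show x ∈ c.source by simp [hc], fun y _ ↦ ?_⟩
  rfl

/-! ### The embedding `ι : Y' ∖ jA'(C) ↪ Y` -/

section Iota

variable {ι : Type*} [Finite ι]

/-- **Away from a closed set containing `K₀` and missing the unit tubes of the other components,
the surgeries on `L` and on `L.someLink` agree.** Let `Y` be presented as surgery on the link `L`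
(components indexed by `Option ι`) with tubular neighbourhoods `ν` and gluing maps `jA`, `jB`,
and `Y'` as surgery on `L.someLink` with the tubular neighbourhoods `ν (some i)` and gluing maps
`jA'`, `jB'`. Let `C ⊆ 𝕊 3` be closed, containing the component `K₀ = L.component none` and
missing the open unit tubes of the components `some i`, and let `U ⊆ Y'` be the open subset with
carrier `(jA' '' {a | ↑a ∈ C})ᶜ`. Then there is an open smooth embedding `ιU : U → Y` with
`ιU (jA' a) = jA a` for `a ∉ C` and `ιU (jB'ᵢ b) = jB (some i) b`, whose range is
`jA '' {a | ↑a ∉ C} ∪ ⋃ᵢ range (jB (some i))`: both `U` and that open subset of `Y` are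
multi-gluings of `(𝕊 3 ∖ L') ∖ C` and `ι` solid tori along the relations `surgeryRel (ν (some i))`
(Kosinski (1993), VI.1, proof of (1.1), and VI.6). [cite: Kosinski1993, Ch. VI §1, proof of Thm (1.1)] -/
theorem Link.exists_iotaEmbedding {L : Link (Option ι)} (ν : ∀ i, Knot.TubularNbhd (L.component i))
    {Y : Type*} [TopologicalSpace Y] [ChartedSpace (𝔼 3) Y] [IsManifold (𝓡 3) ∞ Y]
    {jA : L.complement → Y} {jB : Option ι → solidTorus → Y}
    (hA : Manifold.IsSmoothEmbedding (𝓡 3) (𝓡 3) ∞ jA) (hAo : IsOpen (range jA))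
    (hB : ∀ i, Manifold.IsSmoothEmbedding (𝓘(ℝ, 𝔼 2).prod (𝓡 1)) (𝓡 3) ∞ (jB i) ∧
      IsOpen (range (jB i)))
    (hdisj : Pairwise fun i j ↦ Disjoint (range (jB i)) (range (jB j)))
    (hrel : ∀ i a b, jA a = jB i b ↔ Link.surgeryRel ν i a b)
    {Y' : Type*} [TopologicalSpace Y'] [ChartedSpace (𝔼 3) Y'] [IsManifold (𝓡 3) ∞ Y']
    {jA' : L.someLink.complement → Y'} {jB' : ι → solidTorus → Y'}
    (hA' : Manifold.IsSmoothEmbedding (𝓡 3) (𝓡 3) ∞ jA') (hAo' : IsOpen (range jA'))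
    (hB' : ∀ i, Manifold.IsSmoothEmbedding (𝓘(ℝ, 𝔼 2).prod (𝓡 1)) (𝓡 3) ∞ (jB' i) ∧
      IsOpen (range (jB' i)))
    (hcov' : range jA' ∪ (⋃ i, range (jB' i)) = univ)
    (hdisj' : Pairwise fun i j ↦ Disjoint (range (jB' i)) (range (jB' j)))
    (hrel' : ∀ i a b, jA' a = jB' i b ↔ Link.surgeryRel (fun i ↦ ν (some i)) i a b)
    {C : Set (𝕊 3)} (hC : IsClosed C) (hKC : range (L.component none) ⊆ C)
    (hνC : ∀ (i : ι) (x : 𝕊 1) (w : 𝔼 2), ‖w‖ < 1 → ν (some i) (x, w) ∉ C)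
    (U : TopologicalSpace.Opens Y') (hU : (U : Set Y') = (jA' '' {a | (a : 𝕊 3) ∈ C})ᶜ) :
    ∃ ιU : U → Y, Manifold.IsSmoothEmbedding (𝓡 3) (𝓡 3) ∞ ιU ∧ IsOpen (range ιU) ∧
      (∀ (a : L.someLink.complement) (ha : (a : 𝕊 3) ∈ L.complement) (hmem : jA' a ∈ U),
        ιU ⟨jA' a, hmem⟩ = jA ⟨a, ha⟩) ∧
      (∀ (i : ι) (b : solidTorus) (hmem : jB' i b ∈ U), ιU ⟨jB' i b, hmem⟩ = jB (some i) b) ∧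
      range ιU = jA '' {a | (a : 𝕊 3) ∉ C} ∪ ⋃ i, range (jB (some i)) := by
  -- points glued to a solid torus lie in the open unit tubes, hence off `C`
  have hglueC : ∀ (i : ι) {a : 𝕊 3} {b : (𝔼 2) × (𝕊 1)}, (ν (some i)).glueRel a b → a ∉ C :=
    fun i a b h ↦ by
      obtain ⟨x, w, hw, rfl⟩ := h.exists_eq_apply
      exact hνC i x w hw
  -- the common piece `A₁ = (𝕊 3 ∖ L') ∖ C`, an open subset of both link complements
  set A₁ : TopologicalSpace.Opens (𝕊 3) :=
    ⟨{a | a ∈ L.someLink.complement ∧ a ∉ C}, L.someLink.complement.isOpen.inter hC.isOpen_compl⟩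
    with hA₁
  have hle' : A₁ ≤ L.someLink.complement := fun a ha ↦ ha.1
  have hmemL : ∀ a : 𝕊 3, a ∈ L.someLink.complement → a ∉ C → a ∈ L.complement := by
    intro a ha haC
    rw [Link.mem_complement_iff] at ha ⊢
    rintro (_ | i) hx
    · exact haC (hKC hx)
    · exact ha i (by simpa using hx)
  have hle : A₁ ≤ L.complement := fun a ha ↦ hmemL a ha.1 ha.2
  -- membership in `U`
  have hmemU_A : ∀ a : A₁, jA' (TopologicalSpace.Opens.inclusion hle' a) ∈ U := by
    intro a
    rw [← SetLike.mem_coe, hU]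
    rintro ⟨a', ha'C, ha'⟩
    have : a' = TopologicalSpace.Opens.inclusion hle' a := hA'.isEmbedding.injective ha'
    exact a.2.2 (by rw [this] at ha'C; exact ha'C)
  have hmemU_B : ∀ (i : ι) (b : solidTorus), jB' i b ∈ U := by
    intro i b
    rw [← SetLike.mem_coe, hU]
    rintro ⟨a', ha'C, ha'⟩
    exact hglueC i ((hrel' i a' b).1 ha') ha'C
  -- the multi-gluing presentation of `U`
  set f₁ : A₁ → Y' := jA' ∘ TopologicalSpace.Opens.inclusion hle' with hf₁
  have hf₁emb := isSmoothEmbedding_comp_inclusion (I := 𝓡 3) (J := 𝓡 3) hle' hA'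
  set jA₁ : A₁ → U := fun a ↦ ⟨f₁ a, hmemU_A a⟩ with hjA₁
  obtain ⟨hjA₁emb, hjA₁o⟩ := isSmoothEmbedding_codRestrict_opens hf₁emb.1 (hf₁emb.2 hAo') U hmemU_A
    (ContinuousLinearEquiv.refl ℝ (𝔼 3))
  set jB₁ : ι → solidTorus → U := fun i b ↦ ⟨jB' i b, hmemU_B i b⟩ with hjB₁
  have hjB₁ : ∀ i, Manifold.IsSmoothEmbedding (𝓘(ℝ, 𝔼 2).prod (𝓡 1)) (𝓡 3) ∞ (jB₁ i) ∧
      IsOpen (range (jB₁ i)) := fun i ↦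
    isSmoothEmbedding_codRestrict_opens (hB' i).1 (hB' i).2 U (hmemU_B i) solidTorusModelIso
  have hcov₁ : range jA₁ ∪ (⋃ i, range (jB₁ i)) = univ := by
    refine eq_univ_of_forall fun y ↦ ?_
    have hy : (y : Y') ∈ range jA' ∪ ⋃ i, range (jB' i) := hcov' ▸ mem_univ _
    simp only [mem_union, mem_iUnion, mem_range] at hy ⊢
    rcases hy with ⟨a, ha⟩ | ⟨i, b, hb⟩
    · have haC : (a : 𝕊 3) ∉ C := by
        intro haC
        have : (y : Y') ∈ jA' '' {a | (a : 𝕊 3) ∈ C} := ⟨a, haC, ha⟩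
        have hy' : (y : Y') ∈ (U : Set Y') := y.2
        rw [hU] at hy'
        exact hy' this
      exact Or.inl ⟨⟨a, a.2, haC⟩, Subtype.ext ha⟩
    · exact Or.inr ⟨i, b, Subtype.ext hb⟩
  have hdisj₁ : Pairwise fun i j ↦ Disjoint (range (jB₁ i)) (range (jB₁ j)) := fun i j hij ↦ by
    refine Set.disjoint_left.2 ?_
    rintro _ ⟨b, rfl⟩ ⟨b', hb'⟩
    have : jB' j b' = jB' i b := congrArg Subtype.val hb'
    exact Set.disjoint_left.1 (hdisj' hij) (mem_range_self b) ⟨b', this⟩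
  -- the target open subset of `Y` and its presentation
  have hoA : IsOpen (jA '' {a : L.complement | (a : 𝕊 3) ∉ C}) :=
    (Topology.IsOpenEmbedding.mk hA.isEmbedding hAo).isOpenMap _
      (hC.isOpen_compl.preimage continuous_subtype_val)
  set R₁ : TopologicalSpace.Opens Y :=
    ⟨jA '' {a : L.complement | (a : 𝕊 3) ∉ C} ∪ ⋃ i, range (jB (some i)),
      hoA.union (isOpen_iUnion fun i ↦ (hB (some i)).2)⟩ with hR₁
  set f₂ : A₁ → Y := jA ∘ TopologicalSpace.Opens.inclusion hle with hf₂
  have hf₂emb := isSmoothEmbedding_comp_inclusion (I := 𝓡 3) (J := 𝓡 3) hle hA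
  have hmemR_A : ∀ a : A₁, f₂ a ∈ R₁ := fun a ↦
    Or.inl ⟨TopologicalSpace.Opens.inclusion hle a, a.2.2, rfl⟩
  have hmemR_B : ∀ (i : ι) (b : solidTorus), jB (some i) b ∈ R₁ := fun i b ↦
    Or.inr (mem_iUnion.2 ⟨i, mem_range_self b⟩)
  set jA₂ : A₁ → R₁ := fun a ↦ ⟨f₂ a, hmemR_A a⟩ with hjA₂
  obtain ⟨hjA₂emb, hjA₂o⟩ := isSmoothEmbedding_codRestrict_opens hf₂emb.1 (hf₂emb.2 hAo) R₁ hmemR_A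
    (ContinuousLinearEquiv.refl ℝ (𝔼 3))
  set jB₂ : ι → solidTorus → R₁ := fun i b ↦ ⟨jB (some i) b, hmemR_B i b⟩ with hjB₂
  have hjB₂ : ∀ i, Manifold.IsSmoothEmbedding (𝓘(ℝ, 𝔼 2).prod (𝓡 1)) (𝓡 3) ∞ (jB₂ i) ∧
      IsOpen (range (jB₂ i)) := fun i ↦
    isSmoothEmbedding_codRestrict_opens (hB (some i)).1 (hB (some i)).2 R₁ (hmemR_B i)
      solidTorusModelIso
  have hcov₂ : range jA₂ ∪ (⋃ i, range (jB₂ i)) = univ := by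
    refine eq_univ_of_forall fun y ↦ ?_
    simp only [mem_union, mem_iUnion, mem_range]
    rcases y.2 with ⟨a, haC, ha⟩ | hy
    · exact Or.inl ⟨⟨a, ⟨by
        have := a.2
        rw [Link.mem_complement_iff] at this ⊢
        exact fun i ↦ this (some i), haC⟩⟩, Subtype.ext ha⟩
    · obtain ⟨i, b, hb⟩ : ∃ i b, jB (some i) b = y := by
        simpa only [mem_iUnion, mem_range] using hy
      exact Or.inr ⟨i, b, Subtype.ext hb⟩
  have hdisj₂ : Pairwise fun i j ↦ Disjoint (range (jB₂ i)) (range (jB₂ j)) := fun i j hij ↦ by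
    refine Set.disjoint_left.2 ?_
    rintro _ ⟨b, rfl⟩ ⟨b', hb'⟩
    have : jB (some j) b' = jB (some i) b := congrArg Subtype.val hb'
    exact Set.disjoint_left.1 (hdisj (by simpa using hij)) (mem_range_self b) ⟨b', this⟩
  -- the relations agree
  have hR : ∀ i a b, jA₁ a = jB₁ i b ↔ jA₂ a = jB₂ i b := fun i a b ↦ by
    change (⟨f₁ a, _⟩ : U) = ⟨jB' i b, _⟩ ↔ (⟨f₂ a, _⟩ : R₁) = ⟨jB (some i) b, _⟩
    simp only [Subtype.mk.injEq, hf₁, hf₂, comp_apply]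
    rw [hrel', hrel]
    rfl
  -- the comparison diffeomorphism
  obtain ⟨G, hGA, hGB⟩ := exists_diffeomorph_comp_eq_of_multiGluings hjA₁emb hjA₁o hjB₁ hcov₁ hdisj₁
    hjA₂emb hjA₂o hjB₂ hcov₂ hdisj₂ hR
  refine ⟨Subtype.val ∘ G, isSmoothEmbedding_comp_diffeomorph (Manifold.IsSmoothEmbedding.of_opens R₁) G,
    ?_, fun a ha hmem ↦ ?_, fun i b hmem ↦ ?_, ?_⟩
  · rw [range_comp, (EquivLike.surjective G).range_eq, image_univ, Subtype.range_coe]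
    exact R₁.isOpen
  · have haC : (a : 𝕊 3) ∉ C := by
      intro haC
      have h1 : jA' a ∈ (U : Set Y') := hmem
      rw [hU] at h1
      exact h1 ⟨a, haC, rfl⟩
    have h1 : (⟨jA' a, hmem⟩ : U) = jA₁ ⟨a, a.2, haC⟩ := Subtype.ext rfl
    rw [comp_apply, h1, hGA]
    rfl
  · have h1 : (⟨jB' i b, hmem⟩ : U) = jB₁ i b := Subtype.ext rfl
    rw [comp_apply, h1, hGB]
  · rw [range_comp, (EquivLike.surjective G).range_eq, image_univ, Subtype.range_coe]
    rfl

end Iota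

/-! ### The embedding `β : Z ∖ {φ_Z q₀} ↪ Y` -/

section Beta

variable {ι : Type*} [Finite ι]

set_option maxHeartbeats 800000 in
/-- **The surgered ball around `K₀` is a punctured surgery on another knot.** Let `Y` be
presented as surgery on the link `L` (components indexed by `Option ι`) with tubular
neighbourhoods `ν` and gluing maps `jA`, `jB`; let `Z` be the open gluing of the complement of a
knot `O` and the open solid torus along `surgeryRel ν_O` by `φ_Z`, `ψ_Z`; let `q₀ ∉ O` be a point
off the open unit tube of `ν_O`. Suppose `μ` maps `A₂ = 𝕊 3 ∖ (O ∪ {q₀})` smoothly and injectively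
(with smooth inverse `μinv` on the open image) into `𝕊 3 ∖ L`, matching the tubes up to a
symmetry of the fibre: `μ (ν_O (x, w)) = ν none (x, Fw w)` for `‖w‖ < 1`, where
`Fw (t • v) = t • Fs v` and `T (p, v) = (p, Fs v)` is a diffeomorphism of the solid torus. Then
the open subset `P = Z ∖ {φ_Z q₀}` embeds openly and smoothly into `Y` by `φ_Z a ↦ jA (μ a)`,
`ψ_Z b ↦ jB none (T b)`, with range `jA (μ A₂) ∪ range (jB none)`: both are two-piece open gluings
of `A₂` and the solid torus along `surgeryRel ν_O` (`exists_diffeomorph_comp_eq_of_gluings`;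
Kosinski (1993), VI.1; Rolfsen (1976), §9.F). [cite: Kosinski1993, Ch. VI §1, proof of Thm (1.1)] -/
theorem exists_betaEmbedding {L : Link (Option ι)} (ν : ∀ i, Knot.TubularNbhd (L.component i))
    {Y : Type*} [TopologicalSpace Y] [ChartedSpace (𝔼 3) Y] [IsManifold (𝓡 3) ∞ Y]
    {jA : L.complement → Y} {jB : Option ι → solidTorus → Y}
    (hA : Manifold.IsSmoothEmbedding (𝓡 3) (𝓡 3) ∞ jA) (hAo : IsOpen (range jA))
    (hB : ∀ i, Manifold.IsSmoothEmbedding (𝓘(ℝ, 𝔼 2).prod (𝓡 1)) (𝓡 3) ∞ (jB i) ∧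
      IsOpen (range (jB i)))
    (hrel : ∀ i a b, jA a = jB i b ↔ Link.surgeryRel ν i a b)
    {O : Knot} (νO : Knot.TubularNbhd O)
    {EZ HZ : Type*} [NormedAddCommGroup EZ] [NormedSpace ℝ EZ] [TopologicalSpace HZ]
    {IZ : ModelWithCorners ℝ EZ HZ} [IZ.Boundaryless] {Z : Type*} [TopologicalSpace Z]
    [ChartedSpace HZ Z] [IsManifold IZ ∞ Z] (LZ : EZ ≃L[ℝ] 𝔼 3)
    {φZ : O.complement → Z} {ψZ : solidTorus → Z}
    (hφ : Manifold.IsSmoothEmbedding (𝓡 3) IZ ∞ φZ) (hφo : IsOpen (range φZ))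
    (hψ : Manifold.IsSmoothEmbedding (𝓘(ℝ, 𝔼 2).prod (𝓡 1)) IZ ∞ ψZ) (hψo : IsOpen (range ψZ))
    (hcovZ : range φZ ∪ range ψZ = univ) (hrelZ : ∀ a b, φZ a = ψZ b ↔ surgeryRel νO a b)
    {q₀ : 𝕊 3} (hq₀ : q₀ ∈ O.complement)
    (hq₀ν : ∀ (x : 𝕊 1) (w : 𝔼 2), ‖w‖ < 1 → νO (x, w) ≠ q₀)
    {μ μinv : 𝕊 3 → 𝕊 3} (hμs : ContMDiffOn (𝓡 3) (𝓡 3) ∞ μ {a | a ∉ range O ∧ a ≠ q₀})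
    (hμinvs : ContMDiffOn (𝓡 3) (𝓡 3) ∞ μinv (μ '' {a | a ∉ range O ∧ a ≠ q₀}))
    (hμo : IsOpen (μ '' {a | a ∉ range O ∧ a ≠ q₀}))
    (hleft : ∀ a, a ∉ range O → a ≠ q₀ → μinv (μ a) = a)
    (hμmem : ∀ a, a ∉ range O → a ≠ q₀ → μ a ∈ L.complement)
    (Fs : 𝕊 1 → 𝕊 1) (Fw : 𝔼 2 → 𝔼 2)
    (hFw : ∀ (t : ℝ) (v : 𝕊 1), Fw (t • (v : 𝔼 2)) = t • (Fs v : 𝔼 2))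
    (T : solidTorus ≃ₘ⟮𝓘(ℝ, 𝔼 2).prod (𝓡 1), 𝓘(ℝ, 𝔼 2).prod (𝓡 1)⟯ solidTorus)
    (hT : ∀ b : solidTorus, ((T b : solidTorus) : (𝔼 2) × (𝕊 1)) =
      ((b : (𝔼 2) × (𝕊 1)).1, Fs (b : (𝔼 2) × (𝕊 1)).2))
    (hμν : ∀ (x : 𝕊 1) (w : 𝔼 2), ‖w‖ < 1 → μ (νO (x, w)) = ν none (x, Fw w))
    (P : TopologicalSpace.Opens Z) (hP : (P : Set Z) = {φZ ⟨q₀, hq₀⟩}ᶜ) :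
    ∃ jBP : P → Y, Manifold.IsSmoothEmbedding IZ (𝓡 3) ∞ jBP ∧ IsOpen (range jBP) ∧
      (∀ (a : O.complement) (ha : (a : 𝕊 3) ≠ q₀) (hmem : φZ a ∈ P),
        jBP ⟨φZ a, hmem⟩ = jA ⟨μ a, hμmem _ a.2 ha⟩) ∧
      (∀ (b : solidTorus) (hmem : ψZ b ∈ P), jBP ⟨ψZ b, hmem⟩ = jB none (T b)) ∧
      range jBP = jA '' {a | ∃ a₀ : 𝕊 3, a₀ ∉ range O ∧ a₀ ≠ q₀ ∧ (a : 𝕊 3) = μ a₀} ∪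
        range (jB none) := by
  -- the common piece `A₂ = 𝕊 3 ∖ (O ∪ {q₀})`
  set A₂ : TopologicalSpace.Opens (𝕊 3) :=
    ⟨{a | a ∉ range O ∧ a ≠ q₀}, O.complement.isOpen.inter isOpen_compl_singleton⟩ with hA₂
  have hle : A₂ ≤ O.complement := fun a ha ↦ ha.1
  have hinjμ : InjOn μ {a | a ∉ range O ∧ a ≠ q₀} := fun a ha a' ha' h ↦ by
    rw [← hleft a ha.1 ha.2, ← hleft a' ha'.1 ha'.2, h]
  -- points glued to the solid torus lie in the open unit tube of `ν_O`
  have hglue : ∀ {a : 𝕊 3} {b : (𝔼 2) × (𝕊 1)}, νO.glueRel a b → a ∉ range O ∧ a ≠ q₀ :=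
    fun {a} {b} h ↦ by
      obtain ⟨x, w, hw, rfl⟩ := h.exists_eq_apply
      exact ⟨h.mem_compl_range, hq₀ν x w hw⟩
  -- membership in `P`
  have hmemP_A : ∀ a : A₂, φZ (TopologicalSpace.Opens.inclusion hle a) ∈ P := by
    intro a
    rw [← SetLike.mem_coe, hP]
    intro h
    have : TopologicalSpace.Opens.inclusion hle a = ⟨q₀, hq₀⟩ := hφ.isEmbedding.injective h
    exact a.2.2 (congrArg Subtype.val this)
  have hmemP_B : ∀ b : solidTorus, ψZ b ∈ P := by
    intro b
    rw [← SetLike.mem_coe, hP]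
    intro h
    have h1 : φZ ⟨q₀, hq₀⟩ = ψZ b := h.symm
    rw [hrelZ] at h1
    exact (hglue h1).2 rfl
  -- the presentation of `P`
  set f₁ : A₂ → Z := φZ ∘ TopologicalSpace.Opens.inclusion hle with hf₁
  have hf₁emb := isSmoothEmbedding_comp_inclusion (I := 𝓡 3) (J := IZ) hle hφ
  set jA₁ : A₂ → P := fun a ↦ ⟨f₁ a, hmemP_A a⟩ with hjA₁
  obtain ⟨hjA₁emb, hjA₁o⟩ :=
    isSmoothEmbedding_codRestrict_opens_general hf₁emb.1 (hf₁emb.2 hφo) P hmemP_A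
  set jB₁ : solidTorus → P := fun b ↦ ⟨ψZ b, hmemP_B b⟩ with hjB₁
  obtain ⟨hjB₁emb, hjB₁o⟩ := isSmoothEmbedding_codRestrict_opens_general hψ hψo P hmemP_B
  have hcov₁ : range jA₁ ∪ range jB₁ = univ := by
    refine eq_univ_of_forall fun z ↦ ?_
    rcases (eq_univ_iff_forall.1 hcovZ (z : Z)) with ⟨a, ha⟩ | ⟨b, hb⟩
    · have haq : (a : 𝕊 3) ≠ q₀ := by
        intro haq
        have h1 : a = ⟨q₀, hq₀⟩ := Subtype.ext haq
        have hz : (z : Z) ∈ (P : Set Z) := z.2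
        rw [hP] at hz
        exact hz (by rw [← ha, h1]; exact mem_singleton _)
      exact Or.inl ⟨⟨a, a.2, haq⟩, Subtype.ext ha⟩
    · exact Or.inr ⟨b, Subtype.ext hb⟩
  -- the diffeomorphism `μ : A₂ ≅ μ(A₂)` onto an open subset of the link complement
  set V₂ : TopologicalSpace.Opens (𝕊 3) := ⟨μ '' {a | a ∉ range O ∧ a ≠ q₀}, hμo⟩ with hV₂
  have hleV : V₂ ≤ L.complement := by
    rintro _ ⟨a, ha, rfl⟩
    exact hμmem a ha.1 ha.2
  have hμinv_mem : ∀ v : V₂, μinv v ∈ A₂ := by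
    rintro ⟨_, a, ha, rfl⟩
    change μinv (μ a) ∈ A₂
    rw [hleft a ha.1 ha.2]
    exact ha
  set μd : A₂ ≃ₘ⟮𝓡 3, 𝓡 3⟯ V₂ :=
    { toFun := fun a ↦ ⟨μ a, a, a.2, rfl⟩
      invFun := fun v ↦ ⟨μinv v, hμinv_mem v⟩
      left_inv := fun a ↦ Subtype.ext (hleft a a.2.1 a.2.2)
      right_inv := fun v ↦ by
        obtain ⟨_, a, ha, rfl⟩ := v
        apply Subtype.ext
        change μ (μinv (μ a)) = μ a
        rw [hleft a ha.1 ha.2]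
      contMDiff_toFun := (ContMDiff.subtypeVal_comp_iff V₂ _).1
        (hμs.comp_contMDiff contMDiff_subtype_val fun a ↦ a.2)
      contMDiff_invFun := (ContMDiff.subtypeVal_comp_iff A₂ _).1
        (hμinvs.comp_contMDiff contMDiff_subtype_val fun v ↦ v.2) } with hμd
  -- the target open subset of `Y` and its presentation
  have hoS : IsOpen {a : L.complement | (a : 𝕊 3) ∈ μ '' {a | a ∉ range O ∧ a ≠ q₀}} :=
    hμo.preimage continuous_subtype_val
  have hoA : IsOpen (jA '' {a : L.complement | (a : 𝕊 3) ∈ μ '' {a | a ∉ range O ∧ a ≠ q₀}}) :=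
    (Topology.IsOpenEmbedding.mk hA.isEmbedding hAo).isOpenMap _ hoS
  have hSeq : jA '' {a : L.complement | (a : 𝕊 3) ∈ μ '' {a | a ∉ range O ∧ a ≠ q₀}} =
      jA '' {a | ∃ a₀ : 𝕊 3, a₀ ∉ range O ∧ a₀ ≠ q₀ ∧ (a : 𝕊 3) = μ a₀} := by
    congr 1
    ext a
    constructor
    · rintro ⟨a₀, ha₀, h⟩; exact ⟨a₀, ha₀.1, ha₀.2, h.symm⟩
    · rintro ⟨a₀, h1, h2, h⟩; exact ⟨a₀, ⟨h1, h2⟩, h.symm⟩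
  set R₂ : TopologicalSpace.Opens Y :=
    ⟨jA '' {a | ∃ a₀ : 𝕊 3, a₀ ∉ range O ∧ a₀ ≠ q₀ ∧ (a : 𝕊 3) = μ a₀} ∪ range (jB none),
      (hSeq ▸ hoA).union (hB none).2⟩ with hR₂
  set f₂ : A₂ → Y := (jA ∘ TopologicalSpace.Opens.inclusion hleV) ∘ μd with hf₂
  have hf₂emb : Manifold.IsSmoothEmbedding (𝓡 3) (𝓡 3) ∞ f₂ :=
    (isSmoothEmbedding_comp_inclusion (I := 𝓡 3) (J := 𝓡 3) hleV hA).1.comp_diffeomorph μd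
  have hf₂o : IsOpen (range f₂) := by
    rw [hf₂, range_comp, (EquivLike.surjective μd).range_eq, image_univ]
    exact (isSmoothEmbedding_comp_inclusion (I := 𝓡 3) (J := 𝓡 3) hleV hA).2 hAo
  have hf₂app : ∀ a : A₂, f₂ a = jA ⟨μ a, hμmem _ a.2.1 a.2.2⟩ := fun a ↦ rfl
  have hmemR_A : ∀ a : A₂, f₂ a ∈ R₂ := fun a ↦
    Or.inl ⟨⟨μ a, hμmem _ a.2.1 a.2.2⟩, ⟨a, a.2.1, a.2.2, rfl⟩, rfl⟩
  have hmemR_B : ∀ b : solidTorus, jB none (T b) ∈ R₂ := fun b ↦ Or.inr (mem_range_self _)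
  set jA₂ : A₂ → R₂ := fun a ↦ ⟨f₂ a, hmemR_A a⟩ with hjA₂
  obtain ⟨hjA₂emb, hjA₂o⟩ := isSmoothEmbedding_codRestrict_opens hf₂emb hf₂o R₂ hmemR_A
    (ContinuousLinearEquiv.refl ℝ (𝔼 3))
  have hBT : Manifold.IsSmoothEmbedding (𝓘(ℝ, 𝔼 2).prod (𝓡 1)) (𝓡 3) ∞ (jB none ∘ T) :=
    (hB none).1.comp_diffeomorph T
  have hBTo : IsOpen (range (jB none ∘ T)) := by
    rw [range_comp, (EquivLike.surjective T).range_eq, image_univ]; exact (hB none).2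
  set jB₂ : solidTorus → R₂ := fun b ↦ ⟨jB none (T b), hmemR_B b⟩ with hjB₂
  obtain ⟨hjB₂emb, hjB₂o⟩ := isSmoothEmbedding_codRestrict_opens hBT hBTo R₂ hmemR_B solidTorusModelIso
  have hcov₂ : range jA₂ ∪ range jB₂ = univ := by
    refine eq_univ_of_forall fun y ↦ ?_
    rcases y.2 with ⟨a, ⟨a₀, h1, h2, ha₀⟩, ha⟩ | ⟨b, hb⟩
    · refine Or.inl ⟨⟨a₀, h1, h2⟩, Subtype.ext ?_⟩
      change f₂ ⟨a₀, h1, h2⟩ = y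
      rw [hf₂app, ← ha]
      congr 1
      exact Subtype.ext ha₀.symm
    · refine Or.inr ⟨T.symm b, Subtype.ext ?_⟩
      change jB none (T (T.symm b)) = y
      rw [Diffeomorph.apply_symm_apply, hb]
  -- the relations agree
  have hR : ∀ a b, jA₁ a = jB₁ b ↔ jA₂ a = jB₂ b := fun a b ↦ by
    change (⟨f₁ a, _⟩ : P) = ⟨ψZ b, _⟩ ↔ (⟨f₂ a, _⟩ : R₂) = ⟨jB none (T b), _⟩
    simp only [Subtype.mk.injEq, hf₁, comp_apply, hf₂app]
    rw [hrelZ, hrel]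
    change νO.glueRel (a : 𝕊 3) b ↔ (ν none).glueRel (μ a) (T b : solidTorus)
    rw [hT b]
    constructor
    · rintro ⟨u, t, ht, hb, ha⟩
      refine ⟨u, t, ht, hb, ?_⟩
      change μ a = ν none (u, t • (Fs (b : (𝔼 2) × (𝕊 1)).2 : 𝔼 2))
      rw [ha, hμν u _ (norm_smul_coe_sphere_lt_one ht _), hFw]
    · rintro ⟨u, t, ht, hb, ha⟩
      refine ⟨u, t, ht, hb, ?_⟩
      change μ a = ν none (u, t • (Fs (b : (𝔼 2) × (𝕊 1)).2 : 𝔼 2)) at ha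
      rw [← hFw, ← hμν u _ (norm_smul_coe_sphere_lt_one ht _)] at ha
      have hmem : νO (u, t • ((b : (𝔼 2) × (𝕊 1)).2 : 𝔼 2)) ∈ {a | a ∉ range O ∧ a ≠ q₀} :=
        ⟨νO.apply_mem_compl_range (smul_ne_zero ht.1.ne' (ne_zero_of_mem_unit_sphere _)),
          hq₀ν u _ (norm_smul_coe_sphere_lt_one ht _)⟩
      exact hinjμ a.2 hmem ha
  -- the comparison diffeomorphism
  have hcov₁' : range jA₁ ∪ ⋃ _ : Unit, range jB₁ = univ := by rwa [iUnion_const]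
  have hcov₂' : range jA₂ ∪ ⋃ _ : Unit, range jB₂ = univ := by rwa [iUnion_const]
  obtain ⟨G, hGA, hGB⟩ := exists_diffeomorph_comp_eq_of_multiGluings (jB := fun _ : Unit ↦ jB₁)
    (jB' := fun _ : Unit ↦ jB₂) hjA₁emb hjA₁o (fun _ ↦ ⟨hjB₁emb, hjB₁o⟩) hcov₁'
    Subsingleton.pairwise hjA₂emb hjA₂o (fun _ ↦ ⟨hjB₂emb, hjB₂o⟩) hcov₂' Subsingleton.pairwise
    (fun _ ↦ hR)
  replace hGB : ∀ b, G (jB₁ b) = jB₂ b := hGB ()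
  have hloc : IsLocalDiffeomorph IZ (𝓡 3) ∞ (Subtype.val ∘ G) :=
    fun z ↦ IsLocalDiffeomorphAt.comp (hf := Diffeomorph.isLocalDiffeomorph G z)
      (hg := isLocalDiffeomorph_subtypeVal_opens R₂ (G z))
  have hinjG : Injective (Subtype.val ∘ G) := Subtype.val_injective.comp G.injective
  refine ⟨Subtype.val ∘ G, isSmoothEmbedding_of_isLocalDiffeomorph hloc hinjG LZ,
    ?_, fun a ha hmem ↦ ?_, fun b hmem ↦ ?_, ?_⟩
  · rw [range_comp, (EquivLike.surjective G).range_eq, image_univ, Subtype.range_coe]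
    exact R₂.isOpen
  · have h1 : (⟨φZ a, hmem⟩ : P) = jA₁ ⟨a, a.2, ha⟩ := Subtype.ext rfl
    rw [comp_apply, h1, hGA]
    rfl
  · have h1 : (⟨ψZ b, hmem⟩ : P) = jB₁ b := Subtype.ext rfl
    rw [comp_apply, h1, hGB]
  · rw [range_comp, (EquivLike.surjective G).range_eq, image_univ, Subtype.range_coe]
    rfl

end Beta

end Literature.Topology.FourManifolds
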